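import Summits.BirchSwinnertonDyer.Rank1Residual.X11b.CongruenceLimitBaseChange
import Summits.BirchSwinnertonDyer.Rank1Residual.X11b.FittingOfNoFiniteSubmodulePowerSeries
import Summits.BirchSwinnertonDyer.Rank1Residual.X11b.CharIdealTrivialCharacter
import HarnessLib

/-!
# X11b, routes R1/p2 — the ONE-SIDED congruence limit: the Greenberg-side divisibility
# `Ch(X_ac(A_{g_m})) ⊆ (L_p(g_m))` for the approximating forms transfers to
# `Ch(X_ac(E[p^∞])) ⊆ (L_p(f))` — without the Euler-system side

HONEST FRAMING (cell `b2b-bsdres`, run/shared/lean/b2b/bsd-rank1-residual/, verbatim in every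
file): the goal of the cell is to DELETE the COMBINATION-SHAPED residual classes of the
Birch–Swinnerton-Dyer formula for ALL analytic-rank `≤ 1` elliptic curves over `ℚ` — "full BSD
formula for every rank `≤ 1` curve in class `C`" assembled STRICTLY from published theorems — so
that the rank-`≤ 1` remainder becomes exactly the CONSTRUCTION-SHAPED classes, which are TYPED
(missing-input `Prop`s), NOT attempted. This is not "finishing BSD". Sub-cell
`b2b-bsdres-multr1-p1` (X11b via the re-proof of Castella 2018 Thm. A along the author's erratum):
a RESEARCH ROUTE; no claim beyond the stated class; X11b stays CONSTRUCTION-SHAPED; nothing here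
changes a label; no named fact is introduced (theorems only; no `sorry`).

## What this file kernel-checks, and why it matters for the cell

The erratum (p. 4) proves Thm. 1.1 — the EQUALITY `Ch_Λ(X^Σ_ac(E[p^∞]))Λ^{ur} = (L^Σ_p(f))` — by
transferring the EQUALITY of Thm. 2.3 for the congruent good-ordinary forms `g_m` (weights
`k_m ≡ 2 (mod p−1)`, `k_m > 2`, level `M = N/p` prime to `p`) through (b) `T_{g_m}/p^m ≃ T/p^m`,
Lemma 2.1, Lemma 2.2 and (c) `(L^Σ_p(g_m), p^m) = (L^Σ_p(f), p^m)`; kernel: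
`CongruenceLimit.isTorsion_and_charIdeal_eq_of_congruences` (gen 3). Thm. 2.3 for `g_m` is the
conjunction of TWO divisibilities (`CastellaErratumThm23Skeleton.lean`, this gen): (2.3)
`Ch ⊇ (L_p(g_m))`, the Euler-system side ([CH18], [LV19], [CGS23], [BCK21] — invoked at weights
OUTSIDE the standing hypotheses (H)(a) / `Ξ` / (Heeg) of [CH18]/[LV19], queries Q1/Q3), and (2.5)
`Ch ⊆ (L^Σ_p(g_m))`, the Greenberg side ([FW21, Thm. 4.41] — PREPRINT, but stated with NO weight
condition, for `ρ_g|_{G_{ℚ_p}}` crystalline, i.e. exactly the `g_m` — plus the PUBLISHED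
comparisons [FO12, Cor. 7.2.1], [CGS23, Prop. 1.4.5], [JSW17, Cor. 3.4.2]).

THIS FILE: the limiting argument runs ONE-SIDEDLY. From `Fitt_Λ(X(g_m)) ⊆ (L_m)` for all `m`
(which follows from (2.5) alone: `Fitt₀ ⊆ Ch` for torsion modules, and `Fitt₀ = 0` otherwise —
`fittingIdeal_zero_le_of_charIdeal_le`; NO torsionness of `X(g_m)`, NO Lemma 2.2 for `g_m`, NO
`L ≠ 0` is needed), (b)+Lemma 2.1 (`e`) and (c), Krull's intersection theorem gives
`Fitt_Λ(X(f)) ⊆ (L_p(f))` (`fittingIdeal_le_span_of_congruences`); and if `X(f)` is `Λ`-torsion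
with no nonzero finite submodule — torsion: Cas18 Thm. 2.3 (control, PUB, given `rank E(K) = 1`
and `#Ш(E/K)[p^∞] < ∞`, i.e. GZK); no finite submodule: the statement of Lemma 2.2 FOR `f` itself
(the erratum states Lemma 2.2 for `g` of level `M`, `p ∤ M`, citing "[Gre16] … [HL19, Lem. 3.12] …
[Ski16, Prop. 2.3.3(ii)]"; for `f = f_E`, `p ∥ N`, it is the same general result of [Gre16]
applied to `Sel_𝔭(K_∞, E[p^∞])`, and it is USED INSIDE the published control formula Cas18
Thm. 2.3 ⇐ [JSW17, §3.3], which equates `#ℤ_p/f_ac(0)` with `#X_Γ`, i.e. has `X^Γ = 0`; INPUT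
here, PUB in that sense — query Q5 for the literature seat: page-confirm the (sst)/`p ∥ N`
instance) — then `Fitt_Λ(X(f)) = Ch_Λ(X(f))` (gen 3,
`PowerSeriesDVR.fittingIdeal_zero_eq_charIdeal_of_forall_length`)
and so **`Ch_Λ(X^Σ_ac(E[p^∞])) ⊆ (L^Σ_p(f))`** (`PowerSeriesDVR.charIdeal_le_span_of_congruences_printed`),
whence at the trivial character **`ord_p L_p(f)(𝟙) ≤ ord_p f_ac(0)`** (`addVal_constantCoeff_le_of_map_le_span`)
= route p2's single typed input `LambdaAdicShadow.IMCLowerAtTrivialChar` (`BDPRouteLinks.lean`,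
multr1-p2), which by the PUBLISHED links (BDP)∘(CTL)∘(TAM) is STEP L = `IndexLowerBoundAt`, the
one missing half of BSD(E,p) on `Locus` = X11b ∧ `p ≥ 5` ∧ Ram ∧ `p ∤ ∏ c_ℓ` (the other half,
`ord_p #Ш ≤ ord_p #Ш_an`, is UNCONDITIONAL there from Kolyvagin: `BDPRouteHalvesClass.lean`). Note
the asymmetry with the two-sided argument: there Lemma 2.2 was needed for the `g_m` and not for `f`
(gen 3 remark); here it is needed for `f` and not for the `g_m`.

NET READING for the cell (bookkeeping, labels unchanged, nothing booked): on `Locus` (92.3 % of the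
2 267 348 X11b-shape pairs `N < 5·10⁵`, `p ≥ 5`, census `RouteLoci.lean`) BSD(E,p) ⇐ the ten
PUBLISHED named facts of route p2 + STEP L, and STEP L ⇐ {[FW21, Thm. 4.41] for the crystalline
forms `g_m`, applied INSIDE its printed hypotheses (PREPRINT — the one unrefereed atom)} +
{PUBLISHED: Hida theory (a)+(b) [Ski16, §2.6]; (c) = [Cas20, Thm. 2.11]; the descent (2.4)⇒(2.5)
[FO12, Cor. 7.2.1], [CGS23, Prop. 1.4.5], [JSW17, Cor. 3.4.2]; control Cas18 Thm. 2.3 ⇐ [JSW17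
§3.3] (incl. "no finite submodule" for `X_ac(E[p^∞])`, Q5); (BDP) Cas18 Thm. 3.2} + {KERNEL:
Lemma 2.1 (gens 4–5), this file, evaluation at `𝟙`} — with NO use of the Euler-system side (2.3) and hence none of the
[CH18]/[LV19] standing-hypothesis queries Q1/Q3 (`CastellaErratumThm23Skeleton.lean`). What is
dictionary, as before: the objects `X^Σ_ac`, `L^Σ_p`, `M_g`; FW21's "absolutely irreducible"
(E[p] irreducible with a transvection in the image of `G_K` — `E[p]` ramified at the multiplicative
`q`, `p` odd — is absolutely irreducible; elementary, not kernel-checked here). Route R1's EQUALITY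
(display (5.3) on `ChainLocus ∖ Locus`, where `p ∣ ∏ c_ℓ` and Kolyvagin's bound is not sharp)
still needs (2.3).

## Dictionary for the theorems

`R = Λ_𝒪 = 𝒪⟦T⟧` (`𝒪` a complete DVR; `ℤ_p⟦T⟧`), `S = Λ_𝒪^{ur}` for the base-changed forms,
`I = (p)` or `(ϖ)` (inside the Jacobson radical), `M = X^Σ_ac(E[p^∞])`, `N m = X^Σ_ac(A_{g_m})`,
`L = L^Σ_p(f)`, `Lm m = L^Σ_p(g_m)`; `e m` = (b)∘Lemma 2.1 dualised
(`TorsionControl.selmerTorsionEquiv_of_socle`, `PontryaginCongruence`); `hCh m` = (2.5) for `g_m`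
in the shape FW21 prints it ("the following inclusion of ideals holds", meaningful when the module
is torsion, trivially consistent otherwise); `hc` = (c); `hT`, `hnf` = control + Lemma 2.2 for `f`.

References: F. Castella, *Erratum* (web, n.d.) pp. 2–4 [Castella2018Erratum]; C. Skinner,
Pacific J. Math. 283 (2016) §3.1 [Skinner2016PacificMC]; O. Fouquet, X. Wan, arXiv:2107.13726
Thm. 4.41 [FouquetWan2021]; D. Jetchev, C. Skinner, X. Wan, Camb. J. Math. 5 (2017) Cor. 3.4.2,
§7.4.1 [JetchevSkinnerWan2017]; F. Castella, Camb. J. Math. 6 (2018) Thms. 2.3, 3.2 [Castella2018].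
-/

noncomputable section

open scoped TensorProduct

open Literature.RingTheory.FittingIdeal Literature.NumberTheory.EllipticCurves
  Literature.NumberTheory.EllipticCurves.Module PowerSeries IsDiscreteValuationRing IsLocalRing

namespace Summit.BirchSwinnertonDyer.Rank1Residual.X11b.CongruenceLimit

universe u

/-! ### §1 The one-sided congruence limit for order ideals (any Noetherian ring) -/

section OneSided

variable {R : Type u} [CommRing R] (I : Ideal R)
  {M : Type*} [AddCommGroup M] [Module R M] [Module.Finite R M] {L : R}
  (N : ℕ → Type*) [∀ m, AddCommGroup (N m)] [∀ m, Module R (N m)] [∀ m, Module.Finite R (N m)]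
  (Lm : ℕ → R)

/-- **(Fitt-L-≤) modulo `I^m`.** From `e : M/I^m ≅ N_m/I^m` ((b)∘Lemma 2.1), the ONE-SIDED input
`Fitt₀(N_m) ⊆ (L_m)` ((2.5) for `g_m`) and the congruence `(L_m) + I^m = (L) + I^m` ((c)):
`Fitt₀(M) + I^m ⊆ (L) + I^m` ("basic properties of Fitting ideals": `Fitt₀(M) + I^m =
Fitt₀(N_m) + I^m`, gen 3 `fittingIdeal_sup_eq_of_quotEquiv`). [cite: Castella2018Erratum, proof of Thm. 1.1 (p. 4), display, one inclusion] -/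
theorem fittingIdeal_sup_pow_le_of_congruences
    (e : ∀ m : ℕ, 1 ≤ m →
      ((M ⧸ (I ^ m • (⊤ : Submodule R M))) ≃ₗ[R] (N m ⧸ (I ^ m • (⊤ : Submodule R (N m))))))
    (hF : ∀ m : ℕ, 1 ≤ m → Module.fittingIdeal R (N m) 0 ≤ Ideal.span {Lm m})
    (hc : ∀ m : ℕ, 1 ≤ m → Ideal.span {Lm m} ⊔ I ^ m = Ideal.span {L} ⊔ I ^ m)
    (m : ℕ) (hm : 1 ≤ m) :
    Module.fittingIdeal R M 0 ⊔ I ^ m ≤ Ideal.span {L} ⊔ I ^ m := by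
  rw [fittingIdeal_sup_eq_of_quotEquiv (I ^ m) (e m hm) 0, ← hc m hm]
  exact sup_le_sup_right (hF m hm) _

/-- **The one-sided congruence limit**: under the hypotheses of
`fittingIdeal_sup_pow_le_of_congruences` for every `m ≥ 1`, with `R` Noetherian and `I ⊆ Jac(R)`,
`Fitt₀(M) ⊆ ⋂_m ((L) + I^m) = (L)` (Krull, gen 3 `iInf_sup_pow_eq_self`). No hypothesis `L ≠ 0`,
no torsionness of the `N_m`, no "`Ch = Fitt`" for the `N_m`. [cite: Castella2018Erratum, proof of Thm. 1.1 (p. 4)]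
[cite: Skinner2016PacificMC, §3.1 (p. 192)] -/
theorem fittingIdeal_le_span_of_congruences [IsNoetherianRing R] (hI : I ≤ (⊥ : Ideal R).jacobson)
    (e : ∀ m : ℕ, 1 ≤ m →
      ((M ⧸ (I ^ m • (⊤ : Submodule R M))) ≃ₗ[R] (N m ⧸ (I ^ m • (⊤ : Submodule R (N m))))))
    (hF : ∀ m : ℕ, 1 ≤ m → Module.fittingIdeal R (N m) 0 ≤ Ideal.span {Lm m})
    (hc : ∀ m : ℕ, 1 ≤ m → Ideal.span {Lm m} ⊔ I ^ m = Ideal.span {L} ⊔ I ^ m) :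
    Module.fittingIdeal R M 0 ≤ Ideal.span {L} := by
  rw [← iInf_sup_pow_eq_self I (Ideal.span {L}) hI]
  refine le_iInf fun m => ?_
  rcases Nat.eq_zero_or_pos m with rfl | hm
  · rw [pow_zero, Ideal.one_eq_top, sup_top_eq]; exact le_top
  · exact le_sup_left.trans (fittingIdeal_sup_pow_le_of_congruences I N Lm e hF hc m hm)

end OneSided

/-! ### §2 The input `Fitt₀(N_m) ⊆ (L_m)` from the printed shape of (2.5) / [FW21, Thm. 4.41] -/

section InputShape

variable {R : Type u} [CommRing R] [IsNoetherianRing R] [IsDomain R] [UniqueFactorizationMonoid R]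
  {N : Type*} [AddCommGroup N] [Module R N] [Module.Finite R N]

/-- **"The following inclusion of ideals holds: `Ch(X) ⊆ (L)`" implies `Fitt₀(X) ⊆ (L)`**, for a
finite module over a Noetherian UFD, whether or not `X` is torsion: if torsion, `Fitt₀ ⊆ Ch`
(gen 3 `fittingIdeal_zero_le_charIdeal`); if not, `Fitt₀ ⊆ Ann = 0` (tree
`Module.fittingIdeal_zero_le_annihilator`, `Module.annihilator_eq_bot_of_not_isTorsion`). So the
one-sided limit consumes (2.5) exactly as printed, with no separate torsionness input for the
`g_m` (which in the erratum comes from the Euler-system side, [BCK21, Thm. 5.2]).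
[cite: FouquetWan2021, Thm. 4.41 (shape of the conclusion)] -/
theorem fittingIdeal_zero_le_of_charIdeal_le {L : R}
    (hCh : Module.IsTorsion R N → charIdeal R N ≤ Ideal.span {L}) :
    Module.fittingIdeal R N 0 ≤ Ideal.span {L} := by
  by_cases hN : Module.IsTorsion R N
  · exact (fittingIdeal_zero_le_charIdeal hN).trans (hCh hN)
  · exact (Module.fittingIdeal_zero_le_annihilator.trans
      (Module.annihilator_eq_bot_of_not_isTorsion hN).le).trans bot_le

end InputShape

/-! ### §3 Evaluation at the trivial character, inequality form -/

section TrivialCharacter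

/-- Divisibility is monotone on constant terms and valuations: `(f) ⊆ (L)` in `R₀⟦T⟧` (`R₀` a DVR)
gives `L ∣ f`, `L(0) ∣ f(0)`, hence `ord L(0) ≤ ord f(0)` — generator-independent on both sides.
[folklore] -/
theorem addVal_constantCoeff_le_of_span_le {R₀ : Type*} [CommRing R₀] [IsDomain R₀]
    [IsDiscreteValuationRing R₀] {f L : PowerSeries R₀}
    (h : Ideal.span {f} ≤ Ideal.span {L}) :
    addVal R₀ (constantCoeff L) ≤ addVal R₀ (constantCoeff f) := by
  have hdvd : L ∣ f := Ideal.mem_span_singleton.1 (h (Ideal.mem_span_singleton_self f))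
  exact addVal_le_iff_dvd.mpr (map_dvd constantCoeff hdvd)

/-- **The inequality at `𝟙` after base change** (route p2's `IMCLowerAtTrivialChar`
`ord_p L_p(f)(𝟙) ≤ ord_p f_ac(0)`): if `C = (f_ac)` is a principal ideal of `𝒪⟦T⟧` (`Ch_Λ(X)` or
`Fitt_Λ(X)`) whose extension along `ι : 𝒪 → R₀` (`R₀` a DVR, e.g. `W(𝔽̄_p)`) is contained in
`(L)` (`Ch_Λ(X)Λ_{R₀} ⊆ (L_p(f))`), then `ord L(0) ≤ ord ι(f_ac(0))`. [cite: Castella2018Erratum, Thm. 1.1 (shape, one inclusion)] -/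
theorem addVal_constantCoeff_le_of_map_le_span {𝒪 R₀ : Type*} [CommRing 𝒪] [CommRing R₀]
    [IsDomain R₀] [IsDiscreteValuationRing R₀] (ι : 𝒪 →+* R₀) {C : Ideal (PowerSeries 𝒪)}
    {f : PowerSeries 𝒪} (hC : C = Ideal.span {f}) {L : PowerSeries R₀}
    (hL : Ideal.map (PowerSeries.map ι) C ≤ Ideal.span {L}) :
    addVal R₀ (constantCoeff L) ≤ addVal R₀ (ι (constantCoeff f)) := by
  rw [hC, map_span_singleton_powerSeries] at hL
  rw [← constantCoeff_map_apply]
  exact addVal_constantCoeff_le_of_span_le hL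

end TrivialCharacter

end Summit.BirchSwinnertonDyer.Rank1Residual.X11b.CongruenceLimit

/-! ### §4 Over `Λ_𝒪 = 𝒪⟦T⟧`: the printed-input ONE-SIDED end form -/

namespace Summit.BirchSwinnertonDyer.Rank1Residual.X11b.CongruenceLimit.PowerSeriesDVR

variable {𝒪 : Type} [CommRing 𝒪] [IsDomain 𝒪] [IsDiscreteValuationRing 𝒪]
  [IsAdicComplete (maximalIdeal 𝒪) 𝒪]

/-- **`Ch_Λ(X^Σ_ac(E[p^∞])) ⊆ (L^Σ_p(f))` from the Greenberg side for the `g_m` ALONE — kernel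
form over `Λ_𝒪 = 𝒪⟦T⟧` (`𝒪` any complete DVR), printed inputs.** `e` [(b)+Lemma 2.1:
`M/I^m ≅ N_m/I^m`]; `hCh` [(2.5) for `g_m` as [FW21, Thm. 4.41] ∘ [FO12 7.2.1] ∘ [CGS23 1.4.5] ∘
[JSW17 3.4.2] print it: `Ch(N_m) ⊆ (L_m)` when `N_m` is torsion]; `hc` [(c), Cas20 Thm. 2.11];
`hT` [`M` torsion: Cas18 Thm. 2.3 given `rank E(K) = 1`, `#Ш(E/K)[p^∞] < ∞`]; `hnf` [Lemma 2.2 FOR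
`f`: no nonzero finite-length submodule of `M` — [Gre16]; at `p ∥ N` inside Cas18 Thm. 2.3 ⇐
[JSW17 §3.3], query Q5]. THEN `Fitt_Λ(M) = Ch_Λ(M) ⊆ (L)`. Not used: (2.3),
[CH18], [LV19], [CGS23 5.5.1], [BCK21], `L ≠ 0`, Lemma 2.2 for the `g_m`. Pure algebra; CONDITIONAL
on nothing; deletes nothing; X11b stays CONSTRUCTION-SHAPED. [cite: Castella2018Erratum, proof of Thm. 1.1 (p. 4), read one-sidedly]
[cite: Skinner2016PacificMC, §3.1 (p. 192)] -/
theorem charIdeal_le_span_of_congruences_printed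
    {M : Type} [AddCommGroup M] [Module (PowerSeries 𝒪) M] [Module.Finite (PowerSeries 𝒪) M]
    (N : ℕ → Type) [∀ m, AddCommGroup (N m)] [∀ m, Module (PowerSeries 𝒪) (N m)]
    [∀ m, Module.Finite (PowerSeries 𝒪) (N m)]
    (I : Ideal (PowerSeries 𝒪)) (hI : I ≤ (⊥ : Ideal (PowerSeries 𝒪)).jacobson)
    {L : PowerSeries 𝒪} (Lm : ℕ → PowerSeries 𝒪)
    (e : ∀ m : ℕ, 1 ≤ m →
      ((M ⧸ (I ^ m • (⊤ : Submodule (PowerSeries 𝒪) M))) ≃ₗ[PowerSeries 𝒪]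
        (N m ⧸ (I ^ m • (⊤ : Submodule (PowerSeries 𝒪) (N m))))))
    (hCh : ∀ m : ℕ, 1 ≤ m → Module.IsTorsion (PowerSeries 𝒪) (N m) →
      charIdeal (PowerSeries 𝒪) (N m) ≤ Ideal.span {Lm m})
    (hc : ∀ m : ℕ, 1 ≤ m → Ideal.span {Lm m} ⊔ I ^ m = Ideal.span {L} ⊔ I ^ m)
    (hT : Module.IsTorsion (PowerSeries 𝒪) M)
    (hnf : ∀ N' : Submodule (PowerSeries 𝒪) M, Module.length (PowerSeries 𝒪) N' ≠ ⊤ → N' = ⊥) :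
    Module.fittingIdeal (PowerSeries 𝒪) M 0 = charIdeal (PowerSeries 𝒪) M ∧
      charIdeal (PowerSeries 𝒪) M ≤ Ideal.span {L} := by
  have hFitt : Module.fittingIdeal (PowerSeries 𝒪) M 0 ≤ Ideal.span {L} :=
    fittingIdeal_le_span_of_congruences I N Lm hI e
      (fun m hm => fittingIdeal_zero_le_of_charIdeal_le (hCh m hm)) hc
  have hFC : Module.fittingIdeal (PowerSeries 𝒪) M 0 = charIdeal (PowerSeries 𝒪) M :=
    fittingIdeal_zero_eq_charIdeal_of_forall_length M hT hnf
  exact ⟨hFC, hFC ▸ hFitt⟩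

/-- **At the trivial character** (one ring, `𝒪 = R₀` a complete DVR, e.g. `W(𝔽̄_p)`): under the
same printed inputs, for ANY generator `f_ac` of `Ch_Λ(M)`, `ord L(0) ≤ ord f_ac(0)` — the shape
`LambdaAdicShadow.IMCLowerAtTrivialChar` of route p2 (`BDPRouteLinks.lean`), i.e. STEP L once the
published links (BDP)∘(CTL)∘(TAM) are applied (`indexLowerBoundAt_of_shadowLinks`). [cite: Castella2018Erratum, proof of Thm. 1.1 (p. 4), read one-sidedly]
[cite: JetchevSkinnerWan2017, §7.4.1 (the lower bound from Wan's divisibility)] -/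
theorem addVal_constantCoeff_le_of_congruences_printed
    {M : Type} [AddCommGroup M] [Module (PowerSeries 𝒪) M] [Module.Finite (PowerSeries 𝒪) M]
    (N : ℕ → Type) [∀ m, AddCommGroup (N m)] [∀ m, Module (PowerSeries 𝒪) (N m)]
    [∀ m, Module.Finite (PowerSeries 𝒪) (N m)]
    (I : Ideal (PowerSeries 𝒪)) (hI : I ≤ (⊥ : Ideal (PowerSeries 𝒪)).jacobson)
    {L : PowerSeries 𝒪} (Lm : ℕ → PowerSeries 𝒪)
    (e : ∀ m : ℕ, 1 ≤ m →
      ((M ⧸ (I ^ m • (⊤ : Submodule (PowerSeries 𝒪) M))) ≃ₗ[PowerSeries 𝒪]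
        (N m ⧸ (I ^ m • (⊤ : Submodule (PowerSeries 𝒪) (N m))))))
    (hCh : ∀ m : ℕ, 1 ≤ m → Module.IsTorsion (PowerSeries 𝒪) (N m) →
      charIdeal (PowerSeries 𝒪) (N m) ≤ Ideal.span {Lm m})
    (hc : ∀ m : ℕ, 1 ≤ m → Ideal.span {Lm m} ⊔ I ^ m = Ideal.span {L} ⊔ I ^ m)
    (hT : Module.IsTorsion (PowerSeries 𝒪) M)
    (hnf : ∀ N' : Submodule (PowerSeries 𝒪) M, Module.length (PowerSeries 𝒪) N' ≠ ⊤ → N' = ⊥)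
    {fac : PowerSeries 𝒪} (hfac : charIdeal (PowerSeries 𝒪) M = Ideal.span {fac}) :
    addVal 𝒪 (constantCoeff L) ≤ addVal 𝒪 (constantCoeff fac) := by
  have h := (charIdeal_le_span_of_congruences_printed N I hI Lm e hCh hc hT hnf).2
  rw [hfac] at h
  exact addVal_constantCoeff_le_of_span_le h

end Summit.BirchSwinnertonDyer.Rank1Residual.X11b.CongruenceLimit.PowerSeriesDVR

end
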